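import Literature.NumberTheory.Sieve.ParityWave0
import HarnessLib

/-!
# parity.S29 — Polymath 8a, Lemma 3.1: the subset-sum trichotomy behind the Heath-Brown reduction

Topic `Literature/NumberTheory/Sieve`; a sibling proofs file of `ParityWave0.lean` serving the named
fact `Literature.NumberTheory.Sieve.mpz_of_lt` (**parity.S29**, `MPZ[ϖ, δ]` for `600ϖ + 180δ < 7`;
D. H. J. Polymath, *New equidistribution estimates of Zhang type*, Algebra Number Theory 8 (2014)
2067–2199 = arXiv:1402.0811, Theorem 2.4(i)).  The first step of the printed proof (§3) reduces
`MPZ^{(i)}[ϖ, δ]` to Type I/II/III estimates (Lemma 2.7) by the Heath-Brown identity "combined with a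
purely combinatorial result about finite sets of non-negative numbers" — Lemma 3.1, which sorts the
scales `N_1 ⋯ N_n ∼ x`, `N_i = x^{t_i}`, of each term of the identity into the Type 0 / Type I–II /
Type III alternatives.  This file PROVES Lemma 3.1 verbatim (`MPZ.subsetSum_trichotomy`) and its rider
"if `σ > 1/6`, then the Type III alternative cannot occur" (`MPZ.not_typeIII_of_one_sixth_lt`),
following the printed proof (large/small sets, powerful/powerless elements).  Formalising it shows
that two printed hypotheses are not used: `σ < 1/2` and the non-negativity of the `t_i`.

Nothing here discharges `mpz_of_lt` (its analytic inputs — dispersion, Weil, Deligne — are absent);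
see `ParityWave0MPZProofs.lean` for what is proved about `MPZ` itself.

## References

* D. H. J. Polymath, *New equidistribution estimates of Zhang type*, Algebra Number Theory 8 (2014),
  2067–2199, arXiv:1402.0811, §3, Lemma 3.1 and Remark 3.2. [cite: Polymath8a2014]
-/

open Finset

namespace Literature.NumberTheory.Sieve

/-- **Polymath 8a, Lemma 3.1 (subset-sum trichotomy).**  "Let `1/10 < σ < 1/2`, and let
`t_1, …, t_n` be non-negative real numbers such that `t_1 + ⋯ + t_n = 1`.  Then at least one of the
following three statements holds: (Type 0) There is a `t_i` with `t_i ≥ 1/2 + σ`.  (Type I/II) There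
is a partition `{1, …, n} = S ∪ T` such that `1/2 − σ < ∑_{i ∈ S} t_i ≤ ∑_{i ∈ T} t_i < 1/2 + σ`.
(Type III) There exist distinct `i, j, k` with `2σ ≤ t_i ≤ t_j ≤ t_k ≤ 1/2 − σ` and
`t_i + t_j, t_i + t_k, t_j + t_k ≥ 1/2 + σ`."  Indices form a finite type `ι`, the partition is
`(S, Sᶜ)`.  The printed proof is followed: failing Type 0 and Type I/II, every `S` is *large*
(`∑_S ≥ 1/2 + σ`) or *small* (`∑_S ≤ 1/2 − σ`), singletons are small, complements swap the two; an
index is *powerful* if it turns some small set avoiding it into a large one; small sets stay small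
under adjoining powerless indices, so the powerless indices `P` form a small set, `Pᶜ` is large and
has two (powerful) elements, and for a powerful `i` the complement of the small set `{i} ∪ P`
supplies two more; powerful indices have `t ≥ 2σ`, two of them form a large pair since
`4σ > 1/2 − σ` (this is where `σ > 1/10` enters), and singletons being small gives `t ≤ 1/2 − σ`.
The hypotheses `σ < 1/2` and `t_i ≥ 0` of the print are not needed and omitted.
[cite: Polymath8a2014, Lemma 3.1] -/
theorem MPZ.subsetSum_trichotomy {ι : Type*} [Fintype ι] [DecidableEq ι] {σ : ℝ}
    (hσ : 1 / 10 < σ) (t : ι → ℝ) (hsum : ∑ i, t i = 1) :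
    (∃ i, 1 / 2 + σ ≤ t i) ∨
    (∃ S : Finset ι, 1 / 2 - σ < ∑ i ∈ S, t i ∧ ∑ i ∈ S, t i ≤ ∑ i ∈ Sᶜ, t i ∧
      ∑ i ∈ Sᶜ, t i < 1 / 2 + σ) ∨
    (∃ i j k : ι, i ≠ j ∧ i ≠ k ∧ j ≠ k ∧ 2 * σ ≤ t i ∧ t i ≤ t j ∧ t j ≤ t k ∧
      t k ≤ 1 / 2 - σ ∧ 1 / 2 + σ ≤ t i + t j ∧ 1 / 2 + σ ≤ t i + t k ∧
      1 / 2 + σ ≤ t j + t k) := by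
  classical
  by_cases h0 : ∃ i, 1 / 2 + σ ≤ t i
  · exact Or.inl h0
  by_cases hII : ∃ S : Finset ι, 1 / 2 - σ < ∑ i ∈ S, t i ∧ ∑ i ∈ S, t i ≤ ∑ i ∈ Sᶜ, t i ∧
      ∑ i ∈ Sᶜ, t i < 1 / 2 + σ
  · exact Or.inr (Or.inl hII)
  refine Or.inr (Or.inr ?_)
  push Not at h0
  -- complement sums
  have hcompl : ∀ S : Finset ι, ∑ i ∈ Sᶜ, t i = 1 - ∑ i ∈ S, t i := fun S => by
    rw [eq_sub_iff_add_eq, add_comm, Finset.sum_add_sum_compl, hsum]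
  -- every set is large or small
  have hdich : ∀ S : Finset ι, 1 / 2 + σ ≤ ∑ i ∈ S, t i ∨ ∑ i ∈ S, t i ≤ 1 / 2 - σ := by
    intro S
    by_contra hS
    push Not at hS
    apply hII
    rcases le_or_gt (∑ i ∈ S, t i) (∑ i ∈ Sᶜ, t i) with hle | hgt
    · refine ⟨S, hS.2, hle, ?_⟩
      rw [hcompl]; linarith [hS.1]
    · refine ⟨Sᶜ, ?_, ?_, ?_⟩
      · rw [hcompl]; linarith [hS.1]
      · rw [compl_compl]; exact hgt.le
      · rw [compl_compl]; exact hS.1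
  -- singletons are small
  have hsing : ∀ i, t i ≤ 1 / 2 - σ := fun i => by
    rcases hdich {i} with h | h
    · rw [Finset.sum_singleton] at h; linarith [h0 i]
    · rwa [Finset.sum_singleton] at h
  -- powerful indices; adjoining a powerless index keeps a set small
  have hadd : ∀ i, (¬ ∃ S : Finset ι, i ∉ S ∧ ∑ j ∈ S, t j ≤ 1 / 2 - σ ∧
        1 / 2 + σ ≤ ∑ j ∈ insert i S, t j) →
      ∀ S : Finset ι, ∑ j ∈ S, t j ≤ 1 / 2 - σ → ∑ j ∈ insert i S, t j ≤ 1 / 2 - σ := by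
    intro i hi S hS
    by_cases hiS : i ∈ S
    · rwa [Finset.insert_eq_of_mem hiS]
    rcases hdich (insert i S) with h | h
    · exact absurd ⟨S, hiS, hS, h⟩ hi
    · exact h
  have hunion : ∀ S₀ : Finset ι, ∑ j ∈ S₀, t j ≤ 1 / 2 - σ → ∀ R : Finset ι,
      (∀ i ∈ R, ¬ ∃ S : Finset ι, i ∉ S ∧ ∑ j ∈ S, t j ≤ 1 / 2 - σ ∧
        1 / 2 + σ ≤ ∑ j ∈ insert i S, t j) → ∑ j ∈ S₀ ∪ R, t j ≤ 1 / 2 - σ := by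
    intro S₀ hS₀ R
    induction R using Finset.induction_on with
    | empty => intro; rwa [Finset.union_empty]
    | insert r R hr ih =>
      intro hR
      have h1 := ih fun i hi => hR i (Finset.mem_insert_of_mem hi)
      have h2 := hadd r (hR r (Finset.mem_insert_self r R)) _ h1
      rwa [Finset.union_insert]
  -- the powerless indices
  set P : Finset ι := Finset.univ.filter fun i => ¬ ∃ S : Finset ι, i ∉ S ∧
      ∑ j ∈ S, t j ≤ 1 / 2 - σ ∧ 1 / 2 + σ ≤ ∑ j ∈ insert i S, t j with hP
  have hPpw : ∀ i ∈ P, ¬ ∃ S : Finset ι, i ∉ S ∧ ∑ j ∈ S, t j ≤ 1 / 2 - σ ∧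
      1 / 2 + σ ≤ ∑ j ∈ insert i S, t j := fun i hi => (Finset.mem_filter.mp hi).2
  have hnotP : ∀ i, i ∉ P → ∃ S : Finset ι, i ∉ S ∧ ∑ j ∈ S, t j ≤ 1 / 2 - σ ∧
      1 / 2 + σ ≤ ∑ j ∈ insert i S, t j := fun i hi => by
    by_contra h
    exact hi (Finset.mem_filter.mpr ⟨Finset.mem_univ _, h⟩)
  -- a large set has two elements
  have htwo : ∀ L : Finset ι, 1 / 2 + σ ≤ ∑ j ∈ L, t j → ∃ a ∈ L, ∃ b ∈ L, a ≠ b := by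
    intro L hL
    rw [← Finset.one_lt_card]
    by_contra hc
    push Not at hc
    rcases Finset.eq_empty_or_nonempty L with rfl | ⟨a, ha⟩
    · rw [Finset.sum_empty] at hL; linarith
    · have hLa : L = {a} := Finset.eq_singleton_iff_unique_mem.mpr
        ⟨ha, fun b hb => Finset.card_le_one.mp hc b hb a ha⟩
      rw [hLa, Finset.sum_singleton] at hL
      linarith [hsing a]
  -- powerful indices are `≥ 2σ`, and two of them form a large pair
  have hpw2 : ∀ i, (∃ S : Finset ι, i ∉ S ∧ ∑ j ∈ S, t j ≤ 1 / 2 - σ ∧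
      1 / 2 + σ ≤ ∑ j ∈ insert i S, t j) → 2 * σ ≤ t i := by
    rintro i ⟨S, hiS, hS, hL⟩
    rw [Finset.sum_insert hiS] at hL
    linarith
  have hpair : ∀ i j, i ≠ j →
      (∃ S : Finset ι, i ∉ S ∧ ∑ j ∈ S, t j ≤ 1 / 2 - σ ∧ 1 / 2 + σ ≤ ∑ j ∈ insert i S, t j) →
      (∃ S : Finset ι, j ∉ S ∧ ∑ j ∈ S, t j ≤ 1 / 2 - σ ∧ 1 / 2 + σ ≤ ∑ i ∈ insert j S, t i) →
      1 / 2 + σ ≤ t i + t j := by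
    intro i j hij hi hj
    have h2i := hpw2 i hi
    have h2j := hpw2 j hj
    rcases hdich {i, j} with h | h
    · rwa [Finset.sum_pair hij] at h
    · rw [Finset.sum_pair hij] at h
      linarith
  -- a first powerful index
  obtain ⟨i, hi⟩ : ∃ i, ∃ S : Finset ι, i ∉ S ∧ ∑ j ∈ S, t j ≤ 1 / 2 - σ ∧
      1 / 2 + σ ≤ ∑ j ∈ insert i S, t j := by
    have hempty : ∑ j ∈ (∅ : Finset ι), t j ≤ 1 / 2 - σ := by
      rcases hdich ∅ with h | h
      · rw [Finset.sum_empty] at h; linarith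
      · exact h
    have hPsmall : ∑ j ∈ P, t j ≤ 1 / 2 - σ := by
      have := hunion ∅ hempty P hPpw
      rwa [Finset.empty_union] at this
    have hL : 1 / 2 + σ ≤ ∑ j ∈ Pᶜ, t j := by
      rcases hdich Pᶜ with h | h
      · exact h
      · rw [hcompl] at h; linarith
    obtain ⟨a, ha, -, -, -⟩ := htwo _ hL
    exact ⟨a, hnotP a (Finset.mem_compl.mp ha)⟩
  -- two more
  obtain ⟨j, k, hij, hik, hjk, hj, hk⟩ : ∃ j k, i ≠ j ∧ i ≠ k ∧ j ≠ k ∧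
      (∃ S : Finset ι, j ∉ S ∧ ∑ l ∈ S, t l ≤ 1 / 2 - σ ∧ 1 / 2 + σ ≤ ∑ l ∈ insert j S, t l) ∧
      (∃ S : Finset ι, k ∉ S ∧ ∑ l ∈ S, t l ≤ 1 / 2 - σ ∧ 1 / 2 + σ ≤ ∑ l ∈ insert k S, t l) := by
    have hsmall : ∑ l ∈ {i} ∪ P, t l ≤ 1 / 2 - σ :=
      hunion {i} (by rw [Finset.sum_singleton]; exact hsing i) P hPpw
    have hL : 1 / 2 + σ ≤ ∑ l ∈ ({i} ∪ P)ᶜ, t l := by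
      rcases hdich ({i} ∪ P)ᶜ with h | h
      · exact h
      · rw [hcompl] at h; linarith
    obtain ⟨a, ha, b, hb, hab⟩ := htwo _ hL
    rw [Finset.mem_compl, Finset.mem_union, Finset.mem_singleton, not_or] at ha hb
    exact ⟨a, b, Ne.symm ha.1, Ne.symm hb.1, hab, hnotP a ha.2, hnotP b hb.2⟩
  -- conclude after sorting the three indices
  have key : ∀ a b c : ι, a ≠ b → a ≠ c → b ≠ c →
      (∃ S : Finset ι, a ∉ S ∧ ∑ l ∈ S, t l ≤ 1 / 2 - σ ∧ 1 / 2 + σ ≤ ∑ l ∈ insert a S, t l) →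
      (∃ S : Finset ι, b ∉ S ∧ ∑ l ∈ S, t l ≤ 1 / 2 - σ ∧ 1 / 2 + σ ≤ ∑ l ∈ insert b S, t l) →
      (∃ S : Finset ι, c ∉ S ∧ ∑ l ∈ S, t l ≤ 1 / 2 - σ ∧ 1 / 2 + σ ≤ ∑ l ∈ insert c S, t l) →
      t a ≤ t b → t b ≤ t c →
      ∃ i j k : ι, i ≠ j ∧ i ≠ k ∧ j ≠ k ∧ 2 * σ ≤ t i ∧ t i ≤ t j ∧ t j ≤ t k ∧
        t k ≤ 1 / 2 - σ ∧ 1 / 2 + σ ≤ t i + t j ∧ 1 / 2 + σ ≤ t i + t k ∧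
        1 / 2 + σ ≤ t j + t k :=
    fun a b c hab hac hbc ha hb hc h1 h2 =>
      ⟨a, b, c, hab, hac, hbc, hpw2 a ha, h1, h2, hsing c, hpair a b hab ha hb,
        hpair a c hac ha hc, hpair b c hbc hb hc⟩
  rcases le_total (t i) (t j) with h1 | h1 <;> rcases le_total (t j) (t k) with h2 | h2 <;>
    rcases le_total (t i) (t k) with h3 | h3
  · exact key i j k hij hik hjk hi hj hk h1 h2
  · exact key i j k hij hik hjk hi hj hk h1 h2
  · exact key i k j hik hij hjk.symm hi hk hj h3 h2
  · exact key k i j hik.symm hjk.symm hij hk hi hj h3 h1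
  · exact key j i k hij.symm hjk hik hj hi hk h1 h3
  · exact key j k i hjk hij.symm hik.symm hj hk hi h2 h3
  · exact key k j i hjk.symm hik.symm hij.symm hk hj hi h2 h1
  · exact key k j i hjk.symm hik.symm hij.symm hk hj hi h2 h1

/-- **Polymath 8a, Lemma 3.1, rider**: "if `σ > 1/6`, then the Type III alternative cannot occur"
— "if `σ > 1/6`, then `2σ > 1/2 − σ`, and so the inequalities `2σ ≤ t_i ≤ t_j ≤ t_k ≤ 1/2 − σ` of
the Type III alternative are inconsistent."  (This is why `Type_III` may be omitted from Lemma 2.7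
when `σ > 1/6`, the Deligne-free route of Theorem 2.4(ii).) [cite: Polymath8a2014, Lemma 3.1] -/
theorem MPZ.not_typeIII_of_one_sixth_lt {σ a b c : ℝ} (hσ : 1 / 6 < σ) :
    ¬ (2 * σ ≤ a ∧ a ≤ b ∧ b ≤ c ∧ c ≤ 1 / 2 - σ) := by
  rintro ⟨h1, h2, h3, h4⟩
  linarith

/-- **Remark 3.2**: for `1/10 < σ ≤ 1/6` the Type III alternative does occur — the triple
`(2σ, 1/2 − σ, 1/2 − σ)` sums to `1`, has no entry `≥ 1/2 + σ`, admits no Type I/II partition, and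
is of Type III.  Here only the positive half is recorded: this triple satisfies the Type III
inequalities. [cite: Polymath8a2014, Remark 3.2] -/
theorem MPZ.typeIII_example {σ : ℝ} (hσ : σ ≤ 1 / 6) :
    2 * σ ≤ 2 * σ ∧ 2 * σ ≤ 1 / 2 - σ ∧ 1 / 2 - σ ≤ 1 / 2 - σ ∧ 1 / 2 - σ ≤ 1 / 2 - σ ∧
      1 / 2 + σ ≤ 2 * σ + (1 / 2 - σ) ∧ 1 / 2 + σ ≤ (1 / 2 - σ) + (1 / 2 - σ) ∧
      2 * σ + (1 / 2 - σ) + (1 / 2 - σ) = 1 := by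
  refine ⟨le_rfl, by linarith, le_rfl, le_rfl, by linarith, by linarith, by ring⟩

end Literature.NumberTheory.Sieve
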